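import Summits.MatrixMultiplication.OmegaCensus.STPPSmallPatternKernelSearch

/-!
# ω-census, `(2,1,1)^5` is infeasible in `ℤ/23` — kernel search, part 1 of 2

HONEST FRAMING (pub-omega census; verbatim): lottery ticket; floor = certified bounds/negative ranges.
Census STRUCTURE bookkeeping of the STPP track (seat pub-omega-stpp-3, gen 23; STRUCTURE row B5, the threshold column
`T1(H) = max {k : (2,1,1)^k ⊆ H}`, lower side), not progress on `ω`: small patterns in small groups bound no exponent.

Chunks of the kernel mask search `STPP211Neg.search (zcode 23) 5` (`decide +kernel`; ≈ 134 s of kernel time predicted at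
50 µs per mask translation of the Python mirror); assembled in `STPPSmallPatternNone211K5Z23.lean`.

References: H. Cohn, R. Kleinberg, B. Szegedy, C. Umans, FOCS 2005 (arXiv:math/0511460), Def. 5.1.  Record: pub-omega HOME
`pub-omega-stpp-3-g23/` (plans `py/cells/*.json` from the Python mirror `k211v3.py`; engine cross-checks: lister2/lister2b (gen 22),
gen211.c (gen 21), ENG1's lister211 — all COMPLETE NONE on these cells; not used by the proofs).
-/

set_option Elab.async false  -- several kernel pieces: elaborate sequentially (memory)

namespace Summit.MatrixMultiplication.OmegaCensus

namespace STPP211Neg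

/-- Chunk list 0 of `ℤ/23`, `k = 5` (entries `(d, x1)`: representative `d` of `A₀ = {0,d}`, first-level exclusion mask;
598022 mask translations in the mirror ≈ 30 s predicted). -/
def Z23k5.ch0 : List (ℕ × ℕ) := [(1, 8388601)]

/-- Kernel search over chunk list 0 of `ℤ/23`, `k = 5`. -/
theorem Z23k5.s0 : search (zcode 23) 5 Z23k5.ch0 = true := by
  decide +kernel

/-- Chunk list 1 of `ℤ/23`, `k = 5` (entries `(d, x1)`: representative `d` of `A₀ = {0,d}`, first-level exclusion mask;
1005763 mask translations in the mirror ≈ 50 s predicted). -/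
def Z23k5.ch1 : List (ℕ × ℕ) := [(1, 8388583)]

/-- Kernel search over chunk list 1 of `ℤ/23`, `k = 5`. -/
theorem Z23k5.s1 : search (zcode 23) 5 Z23k5.ch1 = true := by
  decide +kernel

/-- Chunk list 2 of `ℤ/23`, `k = 5` (entries `(d, x1)`: representative `d` of `A₀ = {0,d}`, first-level exclusion mask;
1076587 mask translations in the mirror ≈ 54 s predicted). -/
def Z23k5.ch2 : List (ℕ × ℕ) := [(1, 8388383)]

/-- Kernel search over chunk list 2 of `ℤ/23`, `k = 5`. -/
theorem Z23k5.s2 : search (zcode 23) 5 Z23k5.ch2 = true := by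
  decide +kernel

end STPP211Neg

end Summit.MatrixMultiplication.OmegaCensus
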